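import Mathlib
import HarnessLib

/-!
# Crux `FemtoCurvatureTwoPointC` (stmt-QuantumFields-16204), line `Sketch`:
# `H¹` of the Koszul complex of commuting isometries (`stub_koszulH1`)

Let `S₁, …, S_k` be pairwise commuting norm-preserving linear endomorphisms of a
finite-dimensional real inner product space `W` and put `T_i = S_i - 1`.  A `1`-cocycle of the
associated Koszul complex is a family `X : Fin k → W` with `T_i X_j = T_j X_i`; we show that every
cocycle is a coboundary up to joint fixed vectors: `X_i = T_i m + c_i` with `S_j c_i = c_i` for all
`i, j` (`stub_koszulH1`, taken verbatim as a hypothesis by the lead's `stub_sublevelDoubling`).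

Proof.  Norm-preserving linear maps preserve inner products and are injective, hence (finite
dimension) invertible; write `R_j = S_j⁻¹`, so that `⟪R_j v, w⟫ = ⟪v, S_j w⟫` and `R_j` commutes
with every `S_i`.  Let `Q` be the orthogonal projection onto the joint fixed space
`W₀ = ⋂ ker T_i` and `P = ∑_j (R_j - 1) T_j` (`= ∑_j T_j^* T_j`).  Then
`⟪(P + Q) w, w⟫ = ∑_j ‖T_j w‖² + ⟪Q w, w⟫` with both terms nonnegative, so `F = P + Q` is
injective, hence invertible with inverse `G`, and every `S_i` commutes with `P`, `Q`, `F`, `G`.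
With `m = G (∑_j (R_j - 1) X_j)` the cocycle identity gives `T_i m = G (P X_i)`, and
`X_i = G (F X_i) = G (P X_i) + G (Q X_i)`, where `c_i = G (Q X_i)` is fixed by every `S_j`
because `Q X_i` is.  Pure linear algebra over Mathlib; no named facts.
-/

set_option autoImplicit false

open scoped BigOperators RealInnerProductSpace

namespace Summit.QuantumFields.YangMills.Theorems.FemtoCurvatureTwoPointC

/-- The orthogonal projection `Q` onto the joint fixed space `W₀ = {w | ∀ i, S i w = w}` of a
finite family of inner-product preserving linear maps `S i` of a finite-dimensional real inner
product space, packaged by the four properties used below: its values are fixed by every `S i`,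
`0 ≤ ⟪Q w, w⟫`, it kills every `S i w - w` (these lie in `W₀ᗮ`), and it is the identity on
joint fixed vectors. -/
private theorem exists_fixedSpaceProjection {W : Type} [NormedAddCommGroup W]
    [InnerProductSpace ℝ W] [FiniteDimensional ℝ W] {k : ℕ} (S : Fin k → W →ₗ[ℝ] W)
    (hinner : ∀ i v w, ⟪S i v, S i w⟫ = ⟪v, w⟫) :
    ∃ Q : W →ₗ[ℝ] W,
      (∀ i w, S i (Q w) = Q w) ∧ (∀ w, 0 ≤ ⟪Q w, w⟫) ∧ (∀ i w, Q (S i w - w) = 0) ∧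
        ∀ w, (∀ i, S i w = w) → Q w = w := by
  let W₀ : Submodule ℝ W := ⨅ i, LinearMap.ker (S i - LinearMap.id)
  have hmem : ∀ w, w ∈ W₀ ↔ ∀ i, S i w = w := by
    intro w
    simp [W₀, Submodule.mem_iInf, sub_eq_zero]
  refine ⟨(W₀.starProjection : W →ₗ[ℝ] W), ?_, ?_, ?_, ?_⟩
  · intro i w
    exact (hmem _).1 (W₀.starProjection_apply_mem w) i
  · intro w
    simpa using W₀.re_inner_starProjection_nonneg w
  · intro i w
    have hw : S i w - w ∈ W₀ᗮ := by
      rw [Submodule.mem_orthogonal]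
      intro u hu
      rw [inner_sub_right, ← hinner i u w, (hmem u).1 hu i, sub_self]
    exact (Submodule.starProjection_apply_eq_zero_iff W₀).2 hw
  · intro w hw
    exact Submodule.starProjection_eq_self_iff.2 ((hmem w).2 hw)

/-- **Koszul `H¹` for commuting isometries (`stub_koszulH1`).** Let `S₁,…,S_k` be pairwise
commuting norm-preserving linear maps of a finite-dimensional real inner product space `W`,
`T_i = S_i − 1`. Every `1`-cocycle `X : Fin k → W` (`T_i X_j = T_j X_i`) is a coboundary plus a
joint fixed vector: `X_i = T_i m + c_i` with `S_j c_i = c_i` for all `i, j`.  See the module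
docstring for the proof (`P + Q` with `P = ∑ T_j^* T_j` and `Q` the projection onto the joint
fixed space is invertible and commutes with every `S_i`). -/
theorem stub_koszulH1 :
    ∀ (W : Type) [NormedAddCommGroup W] [InnerProductSpace ℝ W] [FiniteDimensional ℝ W] (k : ℕ)
      (S : Fin k → W →ₗ[ℝ] W), (∀ i w, ‖S i w‖ = ‖w‖) → (∀ i j w, S i (S j w) = S j (S i w)) →
      ∀ X : Fin k → W, (∀ i j, S i (X j) - X j = S j (X i) - X i) →
        ∃ (m : W) (c : Fin k → W), (∀ i j, S i (c j) = c j) ∧ ∀ i, X i = (S i m - m) + c i := by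
  intro W _ _ _ k S hS hcomm X hX
  -- the `S i` preserve inner products and are injective, hence invertible (`R i = (S i)⁻¹`)
  have hinner : ∀ i v w, ⟪S i v, S i w⟫ = ⟪v, w⟫ := fun i =>
    (LinearMap.norm_map_iff_inner_map_map (S i)).1 (hS i)
  have hinj : ∀ i, Function.Injective (S i) := fun i =>
    ({ toLinearMap := S i, norm_map' := hS i } : W →ₗᵢ[ℝ] W).injective
  have hR : ∀ i, ∃ Rᵢ : W →ₗ[ℝ] W, (∀ w, S i (Rᵢ w) = w) ∧ ∀ w, Rᵢ (S i w) = w := fun i =>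
    ⟨((LinearEquiv.ofInjectiveEndo (S i) (hinj i)).symm : W →ₗ[ℝ] W),
      fun w => (LinearEquiv.ofInjectiveEndo (S i) (hinj i)).apply_symm_apply w,
      fun w => (LinearEquiv.ofInjectiveEndo (S i) (hinj i)).symm_apply_apply w⟩
  choose R hSR hRS using hR
  -- `R i` commutes with every `S j`, and `R i` is the adjoint of `S i`
  have hRScomm : ∀ i j w, R i (S j w) = S j (R i w) := by
    intro i j w
    calc R i (S j w) = R i (S j (S i (R i w))) := by rw [hSR]
      _ = R i (S i (S j (R i w))) := by rw [hcomm j i]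
      _ = S j (R i w) := hRS i _
  have hRinner : ∀ i v w, ⟪R i v, w⟫ = ⟪v, S i w⟫ := by
    intro i v w
    rw [← hinner i (R i v) w, hSR]
  -- `Q` = orthogonal projection onto the joint fixed space, `P = ∑ T_j^* T_j`, `F = P + Q`
  obtain ⟨Q, hQfix, hQpos, hQT, hQid⟩ := exists_fixedSpaceProjection S hinner
  obtain ⟨P, hP⟩ : ∃ P : W →ₗ[ℝ] W, ∀ w, P w = ∑ j, (R j (S j w - w) - (S j w - w)) :=
    ⟨∑ j, (R j - 1) * (S j - 1), fun w => by simp [LinearMap.sum_apply]⟩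
  obtain ⟨F, hF⟩ : ∃ F : W →ₗ[ℝ] W, ∀ w, F w = P w + Q w := ⟨P + Q, fun w => rfl⟩
  have hPinner : ∀ w, ⟪P w, w⟫ = ∑ j, ‖S j w - w‖ ^ 2 := by
    intro w
    rw [hP, sum_inner]
    refine Finset.sum_congr rfl fun j _ => ?_
    rw [inner_sub_left, hRinner, ← inner_sub_right, real_inner_self_eq_norm_sq]
  -- `F` is injective (`⟪F w, w⟫ = ∑ ‖T_j w‖² + ⟪Q w, w⟫`), hence invertible with inverse `G`
  have hFinj : Function.Injective F := by
    refine (injective_iff_map_eq_zero F).2 fun w hw => ?_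
    have h1 : ∑ j, ‖S j w - w‖ ^ 2 + ⟪Q w, w⟫ = 0 := by
      rw [← hPinner, ← inner_add_left, ← hF, hw, inner_zero_left]
    have hsum : ∑ j, ‖S j w - w‖ ^ 2 = 0 :=
      le_antisymm (by linarith [hQpos w]) (Finset.sum_nonneg fun j _ => sq_nonneg _)
    have hT : ∀ j, S j w = w := fun j => by
      have := (Finset.sum_eq_zero_iff_of_nonneg fun j _ => sq_nonneg (‖S j w - w‖)).1 hsum j
        (Finset.mem_univ j)
      rwa [sq_eq_zero_iff, norm_eq_zero, sub_eq_zero] at this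
    have hPw : P w = 0 := by
      rw [hP]
      exact Finset.sum_eq_zero fun j _ => by rw [hT j, sub_self, map_zero, sub_self]
    rw [hF, hPw, zero_add, hQid w hT] at hw
    exact hw
  obtain ⟨G, hFG, hGF⟩ : ∃ G : W →ₗ[ℝ] W, (∀ w, F (G w) = w) ∧ ∀ w, G (F w) = w :=
    ⟨((LinearEquiv.ofInjectiveEndo F hFinj).symm : W →ₗ[ℝ] W),
      fun w => (LinearEquiv.ofInjectiveEndo F hFinj).apply_symm_apply w,
      fun w => (LinearEquiv.ofInjectiveEndo F hFinj).symm_apply_apply w⟩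
  -- every `S i` commutes with `P`, `Q`, `F` and `G`
  have hSP : ∀ i w, S i (P w) = P (S i w) := by
    intro i w
    rw [hP, hP, map_sum]
    refine Finset.sum_congr rfl fun j _ => ?_
    simp only [map_sub, ← hRScomm]
    rw [hcomm i j w]
  have hSQ : ∀ i w, S i (Q w) = Q (S i w) := by
    intro i w
    have h := hQT i w
    rw [map_sub, sub_eq_zero] at h
    rw [hQfix, h]
  have hSF : ∀ i w, S i (F w) = F (S i w) := by
    intro i w
    rw [hF, hF, map_add, hSP, hSQ]
  have hSG : ∀ i w, S i (G w) = G (S i w) := by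
    intro i w
    rw [← hGF (S i (G w)), ← hSF, hFG]
  -- `m = G (∑ T_j^* X_j)` and `c i = G (Q (X i))`
  refine ⟨G (∑ j, (R j (X j) - X j)), fun i => G (Q (X i)), fun i j => ?_, fun i => ?_⟩
  · show S i (G (Q (X j))) = G (Q (X j))
    rw [hSG, hQfix]
  · show X i = S i (G (∑ j, (R j (X j) - X j))) - G (∑ j, (R j (X j) - X j)) + G (Q (X i))
    have key : S i (∑ j, (R j (X j) - X j)) - ∑ j, (R j (X j) - X j) = P (X i) := by
      rw [hP, map_sum, ← Finset.sum_sub_distrib]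
      refine Finset.sum_congr rfl fun j _ => ?_
      rw [← hX i j]
      simp only [map_sub, ← hRScomm]
      abel
    calc X i = G (F (X i)) := (hGF _).symm
      _ = G (P (X i)) + G (Q (X i)) := by rw [hF, map_add]
      _ = S i (G (∑ j, (R j (X j) - X j))) - G (∑ j, (R j (X j) - X j)) + G (Q (X i)) := by
        rw [← key, map_sub, hSG]

end Summit.QuantumFields.YangMills.Theorems.FemtoCurvatureTwoPointC
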